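import Summits.ABC.ABC.Theses.IsogenyGlueCongruence
import Summits.ABC.ABC.Theorems.IsogenyGlueCongruenceEllipticGluingPrimeBoundFreeOfBound
import HarnessLib

/-!
# Crux U `EllipticGluingPrimeBound` (stmt-ABC-13919): the SEMISTABLE restriction `U_ss` is all the
# route consumes, and its `d = 1` layer is the semistable curve-wise Frey–Mazur bound (lead c7)

The deciding theorem of route `IsogenyGlueCongruence` uses the crux
`U = Summit.ABC.ABC.Theses.IsogenyGlueCongruence.EllipticGluingPrimeBound` exactly once, through the
glue item `DegreePrimesOfGluingBound : U → ModularJacobianMultipliers → SemistableHeightPolyBound →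
DegreePrimesPolyBounded` (stmt-ABC-13921, `degreePrimesOfGluingBound_proof`), and that glue feeds `U`
only SEMISTABLE curves `W` given by a globally minimal model of conductor `N ≥ 1` (the binders of
`ModularJacobianMultipliers`).  Write `U_ss` for `U` with exactly those binders added:

  `U_ss`: there are absolute `κ ≥ 0`, `C` such that for every semistable elliptic `W/ℚ` (globally
  minimal model, `N = W.conductorNorm ℤ ≥ 1`), every AV-model `(E, e)` of `W`, every abelian variety
  `B/ℚ` and every prime `ℓ`: if a non-zero `E`-multiplier of `B` exists and `ℓ` divides every
  `E`-multiplier of `B`, then `ℓ ≤ C · (dim B · max(1, h_F W))^κ`.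

This file proves, with no input beyond the tree:

* `semistableGluingPrimeBound_of_ellipticGluingPrimeBound` — **U ⟹ U_ss** (restriction);
* `degreePrimesPolyBounded_of_semistableGluingPrimeBound` — **U_ss ⟹ ModularJacobianMultipliers ⟹
  SemistableHeightPolyBound ⟹ DegreePrimesPolyBounded**: the route's glue runs verbatim on `U_ss`
  (same proof as `degreePrimesOfGluingBound_proof`, exponent `4κ`, constant `max C 0 · (max 1 c)^κ`).
  CERTIFIED BY TYPING: everything `U` asserts beyond `U_ss` — CM curves (the Serre-uniformity flank
  R_cm^unif of line `SketchIdeator5`), non-semistable curves and with them all quadratic / quartic /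
  sextic twist families at fixed stable height — is surplus to the route;
* `semistableFreeTorsionBound_of_semistableGluingPrimeBound` — **U_ss ⟹ U_free,ss**: the necessity
  half of line Sketch's reduction (`geomFreeTorsionBound_of_ellipticGluingPrimeBound`, p117323) is
  `W`-pointwise (glue `E` to the partner along `W[ℓ]`, `exists_gluing`), so it restricts to
  semistable `W` with the same `κ`, `C`: height-free torsion sharing `W[ℓ] ↪ A(ℚ̄)` with
  geometrically `E`-free partners `A` costs `ℓ ≤ C((dim A + 1)·max(1, h_F W))^κ`;
* `semistableCurveSharing_of_semistableGluingPrimeBound` — the **`d = 1` shadow of U_ss, height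
  form**: for semistable `W`, ANY elliptic `W'/ℚ` not geometrically isogenous to `W`
  (`Hom(E_ℚ̄, A_ℚ̄) = 0` for the models) and any prime `ℓ` with a `Γ_ℚ`-equivariant injection
  `W[ℓ] ↪ W'(ℚ̄)`: `ℓ ≤ C · max(1, h_F W)^κ` — uniform in the partner `W'`;
* `semistableCongruencePrimeBound_of_semistableGluingPrimeBound` — the same shadow in **conductor
  form**, through the route item `SemistableHeightPolyBound` (`h_F W ≤ c N²`): `ℓ ≤ C' · N^{2κ}`.
  This is the polynomial, partner-uniform form of the curve-wise Frey–Mazur statement for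
  semistable curves (Frey 1997, Conj. 5 shape), which the abc conjecture is known to imply in
  print (Frey's Tate-curve argument at the partner's extra multiplicative primes + Szpiro; for a
  semistable `W`, `log N ≤ log |Δ_min| ≤ 12 h_F + O(1)`, so no twist normalisation is needed —
  unlike for general `W`, where `U`'s bound in the STABLE height is uniform over twist families and,
  for `j ∈ {0, 1728}`, exceeds what that argument yields).

So the honest content of the route's bet, read on what `closes` consumes, is `U_ss`: its `d = 1`
layer is summit-compatible (abc-implied in print), its `d ≥ 2` layer is the Hecke-orbit-floor
statement for level-raised partners of `f_W` (the residual R_gen of `Lines/SketchIdeator5.lean`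
restricted to semistable `W`), and the CM residual R_cm^unif does not meet it at all.

No definitions (the statements are written inline, as in …CMUniform.lean); no named facts; no
`sorry`; standard axioms.  Lands `--supports stmt-ABC-13919`.
-/

noncomputable section

-- `Summit.<Summit>.<Problem>` is the mandated summit-side namespace (CONVENTIONS §2); for the
-- single-conjunct summit `ABC` the two coincide, so the duplicate `ABC.ABC` is deliberate.
set_option linter.dupNamespace false

namespace Summit.ABC.ABC.Theorems.GluingSlices

open CategoryTheory CategoryTheory.Limits AlgebraicGeometry
open Literature.AlgebraicGeometry.Motives
open Summit.ABC.ABC.Theses.IsogenyGlueCongruence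
open Summit.ABC.ABC.Theorems.IsotypicMinkowski

/-! ### `U ⟹ U_ss` and the route's glue on `U_ss` -/

/-- **U ⟹ U_ss**: the crux restricted to semistable curves given by a globally minimal model of
conductor `≥ 1` (the only curves the route's glue `DegreePrimesOfGluingBound` ever feeds it), with
the same exponent and constant. -/
theorem semistableGluingPrimeBound_of_ellipticGluingPrimeBound (hU : EllipticGluingPrimeBound) :
    ∃ κ C : ℝ, 0 ≤ κ ∧ ∀ (W : WeierstrassCurve ℚ) [W.IsElliptic] [W.IsGloballyMinimal]
      [NeZero (W.conductorNorm ℤ)], W.IsSemistable ℤ →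
      ∀ (E B : AbelianVariety.{0} ℚ) (e : E.geomPoints ≃+ W.geomPoints),
      (∀ (σ : Field.absoluteGaloisGroup ℚ) (P : E.geomPoints), e (σ • P) = σ • e P) →
      ∀ ℓ : ℕ, ℓ.Prime →
      (∃ (α : E ⟶ B) (β : B ⟶ E) (n : ℤ), n ≠ 0 ∧ α ≫ β = n • 𝟙 E) →
      (∀ (α : E ⟶ B) (β : B ⟶ E) (n : ℤ), α ≫ β = n • 𝟙 E → (ℓ : ℤ) ∣ n) →
        (ℓ : ℝ) ≤ C * ((B.dim : ℝ) * max 1 W.stableFaltingsHeight) ^ κ := by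
  obtain ⟨κ, C, hκ, h⟩ := hU
  exact ⟨κ, C, hκ, fun W _ _ _ _ E B e he ℓ hℓ hex hall ↦ h W E B e he ℓ hℓ hex hall⟩

/-- **U_ss ⟹ ModularJacobianMultipliers ⟹ SemistableHeightPolyBound ⟹ crux A**
(`DegreePrimesPolyBounded`), exponent `4κ`, constant `max C 0 · (max 1 c)^κ`: the route's glue
`degreePrimesOfGluingBound_proof` (stmt-ABC-13921) run verbatim on the semistable restriction.  For
`W` semistable take `⟨D, E, J, e, he, hdim, hne, hdiv⟩` from the Jacobian item; a prime `ℓ ∣ deg D`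
divides every `E`-multiplier of `J`, so `U_ss` gives `ℓ ≤ C (dim J · max(1, h_F W))^κ`, and
`dim J ≤ N²`, `h_F W ≤ c N²`, `N ≥ 1` give the base `≤ max(1,c) · N⁴`.  Certifies by typing that the
deciding theorem of the route needs `U` only through `U_ss`. -/
theorem degreePrimesPolyBounded_of_semistableGluingPrimeBound
    (hU : ∃ κ C : ℝ, 0 ≤ κ ∧ ∀ (W : WeierstrassCurve ℚ) [W.IsElliptic] [W.IsGloballyMinimal]
      [NeZero (W.conductorNorm ℤ)], W.IsSemistable ℤ →
      ∀ (E B : AbelianVariety.{0} ℚ) (e : E.geomPoints ≃+ W.geomPoints),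
      (∀ (σ : Field.absoluteGaloisGroup ℚ) (P : E.geomPoints), e (σ • P) = σ • e P) →
      ∀ ℓ : ℕ, ℓ.Prime →
      (∃ (α : E ⟶ B) (β : B ⟶ E) (n : ℤ), n ≠ 0 ∧ α ≫ β = n • 𝟙 E) →
      (∀ (α : E ⟶ B) (β : B ⟶ E) (n : ℤ), α ≫ β = n • 𝟙 E → (ℓ : ℤ) ∣ n) →
        (ℓ : ℝ) ≤ C * ((B.dim : ℝ) * max 1 W.stableFaltingsHeight) ^ κ)
    (hJ : ModularJacobianMultipliers) (hH : SemistableHeightPolyBound) :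
    DegreePrimesPolyBounded := by
  unfold Summit.ABC.ABC.Theses.IsogenyGlueCongruence.DegreePrimesPolyBounded
  obtain ⟨κ, C, hκ, hU⟩ := hU
  obtain ⟨c, hc⟩ := hH
  refine ⟨4 * κ, max C 0 * (max 1 c) ^ κ, ?_⟩
  intro W _ _ _ hW
  obtain ⟨D, E, J, e, he, hdim, hne, hdiv⟩ := hJ W hW
  refine ⟨D, fun ℓ hℓ hℓD ↦ ?_⟩
  -- Step 1: the semistable gluing bound applies to the pair (E, J) at the prime ℓ.
  have hU1 : (ℓ : ℝ) ≤ C * ((J.dim : ℝ) * max 1 W.stableFaltingsHeight) ^ κ :=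
    hU W hW E J e he ℓ hℓ hne
      (fun α β n h ↦ (Int.natCast_dvd_natCast.mpr hℓD).trans (hdiv α β n h))
  -- Step 2: bookkeeping in the base.
  set N : ℝ := (W.conductorNorm ℤ : ℝ) with hNdef
  set X : ℝ := (J.dim : ℝ) * max 1 W.stableFaltingsHeight with hXdef
  have hN1 : (1 : ℝ) ≤ N := by
    have h : 1 ≤ W.conductorNorm ℤ := NeZero.one_le
    rw [hNdef]
    exact_mod_cast h
  have hN0 : (0 : ℝ) ≤ N := zero_le_one.trans hN1
  have hN2 : (1 : ℝ) ≤ N ^ 2 := one_le_pow₀ hN1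
  have hmc : (1 : ℝ) ≤ max 1 c := le_max_left _ _
  have hmc0 : (0 : ℝ) ≤ max 1 c := zero_le_one.trans hmc
  have hX0 : 0 ≤ X :=
    mul_nonneg (Nat.cast_nonneg _) (zero_le_one.trans (le_max_left _ _))
  have hmax : max 1 W.stableFaltingsHeight ≤ max 1 c * N ^ 2 := by
    refine max_le ?_ ?_
    · calc (1 : ℝ) = 1 * 1 := (mul_one 1).symm
        _ ≤ max 1 c * N ^ 2 := mul_le_mul hmc hN2 zero_le_one hmc0
    · calc W.stableFaltingsHeight ≤ c * N ^ 2 := hc W hW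
        _ ≤ max 1 c * N ^ 2 :=
          mul_le_mul_of_nonneg_right (le_max_right _ _) (pow_nonneg hN0 2)
  have hXle : X ≤ max 1 c * N ^ (4 : ℕ) := by
    calc X = (J.dim : ℝ) * max 1 W.stableFaltingsHeight := rfl
      _ ≤ N ^ 2 * (max 1 c * N ^ 2) :=
          mul_le_mul hdim hmax (zero_le_one.trans (le_max_left _ _)) (pow_nonneg hN0 2)
      _ = max 1 c * N ^ (4 : ℕ) := by ring
  have hrpow : X ^ κ ≤ (max 1 c * N ^ (4 : ℕ)) ^ κ := Real.rpow_le_rpow hX0 hXle hκ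
  have h4 : N ^ (4 * κ) = (N ^ (4 : ℕ)) ^ κ := by
    rw [← Real.rpow_natCast_mul hN0]
    norm_num
  have hsplit : (max 1 c * N ^ (4 : ℕ)) ^ κ = (max 1 c) ^ κ * N ^ (4 * κ) := by
    rw [Real.mul_rpow hmc0 (pow_nonneg hN0 4), h4]
  -- Step 3: assemble.
  calc (ℓ : ℝ) ≤ C * X ^ κ := hU1
    _ ≤ max C 0 * X ^ κ :=
        mul_le_mul_of_nonneg_right (le_max_left _ _) (Real.rpow_nonneg hX0 κ)
    _ ≤ max C 0 * ((max 1 c) ^ κ * N ^ (4 * κ)) := by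
        rw [← hsplit]
        exact mul_le_mul_of_nonneg_left hrpow (le_max_right _ _)
    _ = max C 0 * (max 1 c) ^ κ * N ^ (4 * κ) := by ring

/-- **Registered stub `stub_semistableGlue` of skeleton v11 (line `SketchIdeator5`), closed**: the
route's glue on the semistable restriction, uncurried registered form of
`degreePrimesPolyBounded_of_semistableGluingPrimeBound`. -/
theorem stub_semistableGlue :
    (∃ κ C : ℝ, 0 ≤ κ ∧ ∀ (W : WeierstrassCurve ℚ) [W.IsElliptic] [W.IsGloballyMinimal]
      [NeZero (W.conductorNorm ℤ)], W.IsSemistable ℤ →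
      ∀ (E B : AbelianVariety.{0} ℚ) (e : E.geomPoints ≃+ W.geomPoints),
      (∀ (σ : Field.absoluteGaloisGroup ℚ) (P : E.geomPoints), e (σ • P) = σ • e P) →
      ∀ ℓ : ℕ, ℓ.Prime →
      (∃ (α : E ⟶ B) (β : B ⟶ E) (n : ℤ), n ≠ 0 ∧ α ≫ β = n • 𝟙 E) →
      (∀ (α : E ⟶ B) (β : B ⟶ E) (n : ℤ), α ≫ β = n • 𝟙 E → (ℓ : ℤ) ∣ n) →
        (ℓ : ℝ) ≤ C * ((B.dim : ℝ) * max 1 W.stableFaltingsHeight) ^ κ) →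
    ModularJacobianMultipliers → SemistableHeightPolyBound → DegreePrimesPolyBounded :=
  fun hU hJ hH ↦ degreePrimesPolyBounded_of_semistableGluingPrimeBound hU hJ hH

/-! ### The necessity half of line Sketch's reduction restricts to semistable curves -/

/-- **U_ss ⟹ U_free,ss** (height-free torsion sharing with geometrically `E`-free partners, for
semistable `W`), with the SAME `κ`, `C`: glue `E` to the partner `A` along the equivariant
embedding `W[ℓ] ↪ A(ℚ̄)` (`exists_gluing`: an abelian variety `B/ℚ` with `dim B = dim A + 1`, a
non-zero `E`-multiplier, and every `E`-multiplier divisible by `ℓ`) and read `U_ss` at `(E, B)`.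
The proof of `geomFreeTorsionBound_of_ellipticGluingPrimeBound` (p117323), `W`-pointwise. -/
theorem semistableFreeTorsionBound_of_semistableGluingPrimeBound
    (hU : ∃ κ C : ℝ, 0 ≤ κ ∧ ∀ (W : WeierstrassCurve ℚ) [W.IsElliptic] [W.IsGloballyMinimal]
      [NeZero (W.conductorNorm ℤ)], W.IsSemistable ℤ →
      ∀ (E B : AbelianVariety.{0} ℚ) (e : E.geomPoints ≃+ W.geomPoints),
      (∀ (σ : Field.absoluteGaloisGroup ℚ) (P : E.geomPoints), e (σ • P) = σ • e P) →
      ∀ ℓ : ℕ, ℓ.Prime →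
      (∃ (α : E ⟶ B) (β : B ⟶ E) (n : ℤ), n ≠ 0 ∧ α ≫ β = n • 𝟙 E) →
      (∀ (α : E ⟶ B) (β : B ⟶ E) (n : ℤ), α ≫ β = n • 𝟙 E → (ℓ : ℤ) ∣ n) →
        (ℓ : ℝ) ≤ C * ((B.dim : ℝ) * max 1 W.stableFaltingsHeight) ^ κ) :
    ∃ κ C : ℝ, 0 ≤ κ ∧ ∀ (W : WeierstrassCurve ℚ) [W.IsElliptic] [W.IsGloballyMinimal]
      [NeZero (W.conductorNorm ℤ)], W.IsSemistable ℤ →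
      ∀ (E A : AbelianVariety.{0} ℚ) (e : E.geomPoints ≃+ W.geomPoints),
      (∀ (σ : Field.absoluteGaloisGroup ℚ) (P : E.geomPoints), e (σ • P) = σ • e P) →
      (∀ f : E.baseChange (AlgebraicClosure ℚ) ⟶ A.baseChange (AlgebraicClosure ℚ), f = 0) →
      ∀ ℓ : ℕ, ℓ.Prime →
      (∃ ι : W.geomTorsion ℓ →+ A.geomPoints, Function.Injective ι ∧
        ∀ (σ : Field.absoluteGaloisGroup ℚ) (P : W.geomTorsion ℓ), ι (σ • P) = σ • ι P) →
        (ℓ : ℝ) ≤ C * (((A.dim : ℝ) + 1) * max 1 W.stableFaltingsHeight) ^ κ := by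
  obtain ⟨κ, C, hκ, hU⟩ := hU
  refine ⟨κ, C, hκ, ?_⟩
  intro W _ _ _ hW E A e he hfree ℓ hℓ hι
  obtain ⟨ι, hι, hιe⟩ := hι
  obtain ⟨B, hdim, hex, hall⟩ := exists_gluing e he hfree hℓ ι hι hιe
  have hB := hU W hW E B e he ℓ hℓ hex hall
  have hcast : ((B.dim : ℕ) : ℝ) = (A.dim : ℝ) + 1 := by rw [hdim]; push_cast; ring
  rwa [hcast] at hB

/-! ### The `d = 1` shadow of `U_ss`: semistable curve-wise torsion sharing, uniform in the partner -/

/-- **`d = 1` shadow of U_ss, height form.** If `U_ss` holds then there are absolute `κ ≥ 0`, `C`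
such that for every semistable elliptic `W/ℚ` (globally minimal model, conductor `≥ 1`), every
elliptic `W'/ℚ` with AV-models `(E, e)`, `(A, e')`, `Hom(E_ℚ̄, A_ℚ̄) = 0` (the partner is not
geometrically isogenous to `W`), and every prime `ℓ` with a `Γ_ℚ`-equivariant injection
`W[ℓ] ↪ W'(ℚ̄)`: `ℓ ≤ C · max(1, h_F W)^κ`.  Proof: transport the injection along `e'⁻¹`, apply
`U_ss ⟹ U_free,ss` at the partner `A` (`dim A = 1`), and absorb `2^κ` into the constant. -/
theorem semistableCurveSharing_of_semistableGluingPrimeBound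
    (hU : ∃ κ C : ℝ, 0 ≤ κ ∧ ∀ (W : WeierstrassCurve ℚ) [W.IsElliptic] [W.IsGloballyMinimal]
      [NeZero (W.conductorNorm ℤ)], W.IsSemistable ℤ →
      ∀ (E B : AbelianVariety.{0} ℚ) (e : E.geomPoints ≃+ W.geomPoints),
      (∀ (σ : Field.absoluteGaloisGroup ℚ) (P : E.geomPoints), e (σ • P) = σ • e P) →
      ∀ ℓ : ℕ, ℓ.Prime →
      (∃ (α : E ⟶ B) (β : B ⟶ E) (n : ℤ), n ≠ 0 ∧ α ≫ β = n • 𝟙 E) →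
      (∀ (α : E ⟶ B) (β : B ⟶ E) (n : ℤ), α ≫ β = n • 𝟙 E → (ℓ : ℤ) ∣ n) →
        (ℓ : ℝ) ≤ C * ((B.dim : ℝ) * max 1 W.stableFaltingsHeight) ^ κ) :
    ∃ κ C : ℝ, 0 ≤ κ ∧ ∀ (W W' : WeierstrassCurve ℚ) [W.IsElliptic] [W.IsGloballyMinimal]
      [NeZero (W.conductorNorm ℤ)] [W'.IsElliptic], W.IsSemistable ℤ →
      ∀ (E A : AbelianVariety.{0} ℚ) (e : E.geomPoints ≃+ W.geomPoints)
      (e' : A.geomPoints ≃+ W'.geomPoints),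
      (∀ (σ : Field.absoluteGaloisGroup ℚ) (P : E.geomPoints), e (σ • P) = σ • e P) →
      (∀ (σ : Field.absoluteGaloisGroup ℚ) (P : A.geomPoints), e' (σ • P) = σ • e' P) →
      (∀ f : E.baseChange (AlgebraicClosure ℚ) ⟶ A.baseChange (AlgebraicClosure ℚ), f = 0) →
      ∀ ℓ : ℕ, ℓ.Prime →
      (∃ ι : W.geomTorsion ℓ →+ W'.geomPoints, Function.Injective ι ∧
        ∀ (σ : Field.absoluteGaloisGroup ℚ) (P : W.geomTorsion ℓ), ι (σ • P) = σ • ι P) →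
        (ℓ : ℝ) ≤ C * (max 1 W.stableFaltingsHeight) ^ κ := by
  obtain ⟨κ, C, hκ, h⟩ := semistableFreeTorsionBound_of_semistableGluingPrimeBound hU
  refine ⟨κ, max C 0 * (2 : ℝ) ^ κ, hκ, ?_⟩
  intro W W' _ _ _ _ hW E A e e' he he' hfree ℓ hℓ hι
  obtain ⟨ι, hinj, hιeq⟩ := hι
  -- transport the embedding along `e'⁻¹ : W'(ℚ̄) ≃ A(ℚ̄)`
  have he'symm : ∀ (σ : Field.absoluteGaloisGroup ℚ) (Q : W'.geomPoints),
      e'.symm (σ • Q) = σ • e'.symm Q := by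
    intro σ Q
    apply e'.injective
    rw [he', e'.apply_symm_apply, e'.apply_symm_apply]
  let ι' : W.geomTorsion ℓ →+ A.geomPoints := (e'.symm : W'.geomPoints →+ A.geomPoints).comp ι
  have hι' : ∃ ι' : W.geomTorsion ℓ →+ A.geomPoints, Function.Injective ι' ∧
      ∀ (σ : Field.absoluteGaloisGroup ℚ) (P : W.geomTorsion ℓ), ι' (σ • P) = σ • ι' P := by
    refine ⟨ι', e'.symm.injective.comp hinj, fun σ P ↦ ?_⟩
    show e'.symm (ι (σ • P)) = σ • e'.symm (ι P)
    rw [hιeq, he'symm]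
  have hA1 : A.dim = 1 := dim_eq_one_of_equiv e'
  have hbound := h W hW E A e he hfree ℓ hℓ hι'
  -- absorb `(dim A + 1)^κ = 2^κ` into the constant
  set m : ℝ := max 1 W.stableFaltingsHeight with hm
  have hm1 : (1 : ℝ) ≤ m := le_max_left _ _
  have hm0 : (0 : ℝ) ≤ m := zero_le_one.trans hm1
  have hdim : ((A.dim : ℝ) + 1) = 2 := by rw [hA1]; norm_num
  rw [hdim] at hbound
  have hsplit : ((2 : ℝ) * m) ^ κ = (2 : ℝ) ^ κ * m ^ κ := Real.mul_rpow (by norm_num) hm0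
  calc (ℓ : ℝ) ≤ C * ((2 : ℝ) * m) ^ κ := hbound
    _ ≤ max C 0 * ((2 : ℝ) * m) ^ κ :=
        mul_le_mul_of_nonneg_right (le_max_left _ _) (Real.rpow_nonneg (by positivity) κ)
    _ = max C 0 * (2 : ℝ) ^ κ * m ^ κ := by rw [hsplit, mul_assoc]

/-- **`d = 1` shadow of U_ss, conductor form** (the semistable curve-wise Frey–Mazur bound,
polynomial in the conductor and uniform in the partner).  If `U_ss` and the route item
`SemistableHeightPolyBound` (`h_F W ≤ c N²`) hold, then there are absolute `κ' ≥ 0`, `C'` such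
that for every semistable elliptic `W/ℚ` of conductor `N` (globally minimal model), every elliptic
`W'/ℚ` not geometrically isogenous to `W` (models `(E, e)`, `(A, e')`, `Hom(E_ℚ̄, A_ℚ̄) = 0`) and
every prime `ℓ` with a `Γ_ℚ`-equivariant injection `W[ℓ] ↪ W'(ℚ̄)`: `ℓ ≤ C' · N^{κ'}`
(`κ' = 2κ`, `C' = max C 0 · (max 1 c)^κ`).  This is the statement the abc conjecture implies in
print (Frey 1997: Tate curve at the partner's extra multiplicative primes + Szpiro). -/
theorem semistableCongruencePrimeBound_of_semistableGluingPrimeBound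
    (hU : ∃ κ C : ℝ, 0 ≤ κ ∧ ∀ (W : WeierstrassCurve ℚ) [W.IsElliptic] [W.IsGloballyMinimal]
      [NeZero (W.conductorNorm ℤ)], W.IsSemistable ℤ →
      ∀ (E B : AbelianVariety.{0} ℚ) (e : E.geomPoints ≃+ W.geomPoints),
      (∀ (σ : Field.absoluteGaloisGroup ℚ) (P : E.geomPoints), e (σ • P) = σ • e P) →
      ∀ ℓ : ℕ, ℓ.Prime →
      (∃ (α : E ⟶ B) (β : B ⟶ E) (n : ℤ), n ≠ 0 ∧ α ≫ β = n • 𝟙 E) →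
      (∀ (α : E ⟶ B) (β : B ⟶ E) (n : ℤ), α ≫ β = n • 𝟙 E → (ℓ : ℤ) ∣ n) →
        (ℓ : ℝ) ≤ C * ((B.dim : ℝ) * max 1 W.stableFaltingsHeight) ^ κ)
    (hH : SemistableHeightPolyBound) :
    ∃ κ C : ℝ, 0 ≤ κ ∧ ∀ (W W' : WeierstrassCurve ℚ) [W.IsElliptic] [W.IsGloballyMinimal]
      [NeZero (W.conductorNorm ℤ)] [W'.IsElliptic], W.IsSemistable ℤ →
      ∀ (E A : AbelianVariety.{0} ℚ) (e : E.geomPoints ≃+ W.geomPoints)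
      (e' : A.geomPoints ≃+ W'.geomPoints),
      (∀ (σ : Field.absoluteGaloisGroup ℚ) (P : E.geomPoints), e (σ • P) = σ • e P) →
      (∀ (σ : Field.absoluteGaloisGroup ℚ) (P : A.geomPoints), e' (σ • P) = σ • e' P) →
      (∀ f : E.baseChange (AlgebraicClosure ℚ) ⟶ A.baseChange (AlgebraicClosure ℚ), f = 0) →
      ∀ ℓ : ℕ, ℓ.Prime →
      (∃ ι : W.geomTorsion ℓ →+ W'.geomPoints, Function.Injective ι ∧
        ∀ (σ : Field.absoluteGaloisGroup ℚ) (P : W.geomTorsion ℓ), ι (σ • P) = σ • ι P) →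
        (ℓ : ℝ) ≤ C * (W.conductorNorm ℤ : ℝ) ^ κ := by
  obtain ⟨κ, C, hκ, h⟩ := semistableCurveSharing_of_semistableGluingPrimeBound hU
  obtain ⟨c, hc⟩ := hH
  refine ⟨2 * κ, max C 0 * (max 1 c) ^ κ, by positivity, ?_⟩
  intro W W' _ _ _ _ hW E A e e' he he' hfree ℓ hℓ hι
  have hb := h W W' hW E A e e' he he' hfree ℓ hℓ hι
  set N : ℝ := (W.conductorNorm ℤ : ℝ) with hNdef
  have hN1 : (1 : ℝ) ≤ N := by
    have h1 : 1 ≤ W.conductorNorm ℤ := NeZero.one_le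
    rw [hNdef]
    exact_mod_cast h1
  have hN0 : (0 : ℝ) ≤ N := zero_le_one.trans hN1
  have hN2 : (1 : ℝ) ≤ N ^ 2 := one_le_pow₀ hN1
  have hmc : (1 : ℝ) ≤ max 1 c := le_max_left _ _
  have hmc0 : (0 : ℝ) ≤ max 1 c := zero_le_one.trans hmc
  have hm0 : (0 : ℝ) ≤ max 1 W.stableFaltingsHeight := zero_le_one.trans (le_max_left _ _)
  have hmax : max 1 W.stableFaltingsHeight ≤ max 1 c * N ^ (2 : ℕ) := by
    refine max_le ?_ ?_
    · calc (1 : ℝ) = 1 * 1 := (mul_one 1).symm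
        _ ≤ max 1 c * N ^ 2 := mul_le_mul hmc hN2 zero_le_one hmc0
    · calc W.stableFaltingsHeight ≤ c * N ^ 2 := hc W hW
        _ ≤ max 1 c * N ^ 2 :=
          mul_le_mul_of_nonneg_right (le_max_right _ _) (pow_nonneg hN0 2)
  have hrpow : (max 1 W.stableFaltingsHeight) ^ κ ≤ (max 1 c * N ^ (2 : ℕ)) ^ κ :=
    Real.rpow_le_rpow hm0 hmax hκ
  have h2 : N ^ (2 * κ) = (N ^ (2 : ℕ)) ^ κ := by
    rw [← Real.rpow_natCast_mul hN0]
    norm_num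
  have hsplit : (max 1 c * N ^ (2 : ℕ)) ^ κ = (max 1 c) ^ κ * N ^ (2 * κ) := by
    rw [Real.mul_rpow hmc0 (pow_nonneg hN0 2), h2]
  calc (ℓ : ℝ) ≤ C * (max 1 W.stableFaltingsHeight) ^ κ := hb
    _ ≤ max C 0 * (max 1 W.stableFaltingsHeight) ^ κ :=
        mul_le_mul_of_nonneg_right (le_max_left _ _) (Real.rpow_nonneg hm0 κ)
    _ ≤ max C 0 * ((max 1 c) ^ κ * N ^ (2 * κ)) := by
        rw [← hsplit]
        exact mul_le_mul_of_nonneg_left hrpow (le_max_right _ _)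
    _ = max C 0 * (max 1 c) ^ κ * N ^ (2 * κ) := by ring

/-- **The `d = 1` conductor-form shadow, from the crux itself** (composition of the above with
`U ⟹ U_ss`): `EllipticGluingPrimeBound` and `SemistableHeightPolyBound` give, for semistable `W`
of conductor `N` and ANY partner curve `W'` not geometrically isogenous to `W`, congruence primes
`ℓ ≤ C · N^κ` — uniform in `W'`. -/
theorem semistableCongruencePrimeBound_of_ellipticGluingPrimeBound
    (hU : EllipticGluingPrimeBound) (hH : SemistableHeightPolyBound) :
    ∃ κ C : ℝ, 0 ≤ κ ∧ ∀ (W W' : WeierstrassCurve ℚ) [W.IsElliptic] [W.IsGloballyMinimal]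
      [NeZero (W.conductorNorm ℤ)] [W'.IsElliptic], W.IsSemistable ℤ →
      ∀ (E A : AbelianVariety.{0} ℚ) (e : E.geomPoints ≃+ W.geomPoints)
      (e' : A.geomPoints ≃+ W'.geomPoints),
      (∀ (σ : Field.absoluteGaloisGroup ℚ) (P : E.geomPoints), e (σ • P) = σ • e P) →
      (∀ (σ : Field.absoluteGaloisGroup ℚ) (P : A.geomPoints), e' (σ • P) = σ • e' P) →
      (∀ f : E.baseChange (AlgebraicClosure ℚ) ⟶ A.baseChange (AlgebraicClosure ℚ), f = 0) →
      ∀ ℓ : ℕ, ℓ.Prime →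
      (∃ ι : W.geomTorsion ℓ →+ W'.geomPoints, Function.Injective ι ∧
        ∀ (σ : Field.absoluteGaloisGroup ℚ) (P : W.geomTorsion ℓ), ι (σ • P) = σ • ι P) →
        (ℓ : ℝ) ≤ C * (W.conductorNorm ℤ : ℝ) ^ κ :=
  semistableCongruencePrimeBound_of_semistableGluingPrimeBound
    (semistableGluingPrimeBound_of_ellipticGluingPrimeBound hU) hH

end Summit.ABC.ABC.Theorems.GluingSlices

end
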